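import Literature.Geometry.Riemannian.PerelmanEntropyMonotonicityProofs
import Literature.Geometry.Riemannian.CanonicalNeighbourhoods
import Literature.Geometry.Riemannian.KappaNoncollapsingScaling
import Literature.Geometry.Riemannian.CurvatureNormSq
import HarnessLib

/-!
# Uniform volume lower bound for the rescaled slices of a Ricci flow on a closed 4-manifold
(stub `stub_rescaledNoncollapsed` of line `margerin-cone-hamilton-rails`, crux
`EntropyRung.ChangGurskyYang`, item stmt-SmoothPoincare4-10834)

The volume hypothesis of Hamilton's compactness theorem for the blow-up sequence
`g_k = Q_k • g(t_k)` of a Ricci flow `g` on `[0, T)` on a closed 4-manifold: there are `κ, r₀ > 0`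
(depending only on the flow) such that for every time `t₀ ∈ [T/2, T)`, every `Q ≥ 1` with
`|Rm|² ≤ Q²` on `M × [0, t₀]` and every base point `x₀`,
`Vol_{Q g(t₀)}(B_{Q g(t₀)}(x₀, r₀)) ≥ κ r₀⁴`.

Proof (Perelman 2002, §4, Thm. 4.1 with the scale invariance of `κ`-noncollapsing): Perelman's
no local collapsing theorem I, a THEOREM of the tree (`perelman_noLocalCollapsing_holds`), gives
`κ > 0` such that the flow is `κ`-noncollapsed (parabolic form `IsKappaNoncollapsed`) on every
scale `< √T`. Put `r₀ := min 1 (√T / 2)`. Given `t₀, Q, x₀`, apply noncollapsing at `(x₀, t₀)` on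
the scale `ρ := r₀ / √Q ≤ r₀` of the ORIGINAL metric: the window `[t₀ - ρ², t₀]` lies in `[0, t₀]`
(`ρ² ≤ r₀² ≤ T/4 ≤ t₀`), where the frame bound `|Rm| ≤ √(Q²) = Q ≤ Q / r₀² = ρ⁻²`
(`curvatureBoundedBy_of_curvNormSqWith_le`, `r₀ ≤ 1`) holds; hence
`Vol_{t₀}(B_{t₀}(x₀, ρ)) ≥ κ ρ⁴`. For the rescaled metric `Q g(t₀)` the ball of radius
`r₀ = √Q ρ` is `B_{t₀}(x₀, ρ)` (`ball_constSmul_ofReal`) and volumes scale by `Q²`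
(`vol_constSmul_four`), so `Vol ≥ Q² κ ρ⁴ = κ r₀⁴`. Everything is proved; no definition, no
named fact.

References: G. Perelman, arXiv:math/0211159, §4, Thm. 4.1 and Def. 4.2 [Perelman2002];
B.-L. Chen, X.-P. Zhu, arXiv:math/0504478, §3, p. 7 and §4, p. 19 [ChenZhu2006];
R. S. Hamilton, Amer. J. Math. 117 (1995) 545–572, Thm. 1.2 [Hamilton1995].
-/

noncomputable section

-- every Summit.SmoothPoincare4.SmoothPoincare4.… name repeats the summit = sub-problem segment (D-0017 layout)
set_option linter.dupNamespace false

open Set Function Filter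
open scoped Manifold ContDiff Topology ENNReal

namespace Summit.SmoothPoincare4.SmoothPoincare4.Theorems.MargerinRails

open Literature.Geometry.Riemannian Literature.Geometry.Lorentzian
  Literature.Geometry.Lorentzian.PseudoRiemannianMetric

/-- **Uniform noncollapsing of the rescaled slices** (Perelman 2002, Thm. 4.1 = tree theorem
`perelman_noLocalCollapsing_holds`, plus scale invariance of `κ`-noncollapsing): for a Ricci flow of
Riemannian metrics on `[0, T)`, `T > 0`, on a closed 4-manifold there are `κ, r₀ > 0` such that for
all `t₀ ∈ [T/2, T)`, `Q ≥ 1` with `|Rm|² ≤ Q²` on `M × [0, t₀]`, and all `x₀`,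
`κ r₀⁴ ≤ Vol_{Q g(t₀)}(B_{Q g(t₀)}(x₀, r₀))`. Proof: `r₀ = min 1 (√T/2)`; noncollapsing of `g` at
`(x₀, t₀)` on the scale `ρ = r₀/√Q` (window `[t₀ - ρ², t₀] ⊆ [0, t₀]`, frame bound
`|Rm| ≤ Q ≤ ρ⁻²` by `curvatureBoundedBy_of_curvNormSqWith_le`), then `B_{Q g}(x₀, √Q ρ) = B_g(x₀, ρ)`
(`ball_constSmul_ofReal`) and `Vol_{Q g} = Q² Vol_g` (`vol_constSmul_four`).
[cite: Perelman2002, §4, Thm. 4.1 and Def. 4.2] [cite: ChenZhu2006, §3, p. 7] -/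
theorem stub_rescaledNoncollapsed :
    ∀ (M : Type) [TopologicalSpace M] [T2Space M] [SecondCountableTopology M]
      [ChartedSpace (EuclideanSpace ℝ (Fin 4)) M] [IsManifold (𝓡 4) ∞ M] [CompactSpace M]
      [MeasurableSpace M] [BorelSpace M]
      (g : ℝ → PseudoRiemannianMetric (𝓡 4) ∞ (EuclideanSpace ℝ (Fin 4)) (TangentSpace (𝓡 4) : M → Type _))
      (cov : ℝ → CovariantDerivative (𝓡 4) (EuclideanSpace ℝ (Fin 4)) (TangentSpace (𝓡 4) : M → Type _))
      (T : ℝ), 0 < T → IsRicciFlow g cov (Ico 0 T) → (∀ t ∈ Ico 0 T, (g t).IsRiemannian) →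
      ∃ κ r₀ : ℝ, 0 < κ ∧ 0 < r₀ ∧ ∀ (t₀ Q : ℝ) (hQ : 1 ≤ Q), t₀ ∈ Ico 0 T → T / 2 ≤ t₀ →
        (∀ s ∈ Icc 0 t₀, ∀ x : M, (g s).curvNormSqWith (cov s) x ≤ Q ^ 2) →
        ∀ x₀ : M, ENNReal.ofReal (κ * r₀ ^ 4) ≤
          ((g t₀).constSmul Q (one_pos.trans_le hQ).ne').vol
            (((g t₀).constSmul Q (one_pos.trans_le hQ).ne').ball x₀ (ENNReal.ofReal r₀)) := by
  intro M _ _ _ _ _ _ _ _ g cov T hT hflow hRiem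
  -- Perelman's no local collapsing: `κ`-noncollapsing on every scale `< √T`
  obtain ⟨κ, hκ, hnc⟩ := perelman_noLocalCollapsing_holds (𝓡 4) M T hT g cov hflow hRiem
  have hsT : 0 < Real.sqrt T := Real.sqrt_pos.mpr hT
  obtain ⟨r₀, hr₀_def⟩ : ∃ r : ℝ, r = min 1 (Real.sqrt T / 2) := ⟨_, rfl⟩
  have hr₀pos : 0 < r₀ := by rw [hr₀_def]; exact lt_min one_pos (by positivity)
  have hr₀le1 : r₀ ≤ 1 := hr₀_def ▸ min_le_left _ _
  have hr₀le : r₀ ≤ Real.sqrt T / 2 := hr₀_def ▸ min_le_right _ _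
  have hr₀lt : r₀ < Real.sqrt T := hr₀le.trans_lt (by linarith)
  have hr₀sq : r₀ ^ 2 ≤ T / 4 := by
    have h2 : r₀ ^ 2 ≤ (Real.sqrt T / 2) ^ 2 := pow_le_pow_left₀ hr₀pos.le hr₀le 2
    rw [div_pow, Real.sq_sqrt hT.le] at h2
    linarith
  refine ⟨κ, r₀, hκ, hr₀pos, ?_⟩
  intro t₀ Q hQ ht₀ hTt₀ hcurv x₀
  have hQpos : 0 < Q := one_pos.trans_le hQ
  have hsQ : 0 < Real.sqrt Q := Real.sqrt_pos.mpr hQpos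
  have hsQ1 : 1 ≤ Real.sqrt Q := by rw [← Real.sqrt_one]; exact Real.sqrt_le_sqrt hQ
  -- the scale `ρ = r₀ / √Q` for the original metric
  obtain ⟨ρ, hρ_def⟩ : ∃ r : ℝ, r = r₀ / Real.sqrt Q := ⟨_, rfl⟩
  have hρpos : 0 < ρ := by rw [hρ_def]; exact div_pos hr₀pos hsQ
  have hρle : ρ ≤ r₀ := by rw [hρ_def]; exact div_le_self hr₀pos.le hsQ1
  have hρlt : ρ < Real.sqrt T := hρle.trans_lt hr₀lt
  have hρr : Real.sqrt Q * ρ = r₀ := by rw [hρ_def, mul_div_cancel₀ _ hsQ.ne']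
  have hρsq : ρ ^ 2 = r₀ ^ 2 / Q := by rw [hρ_def, div_pow, Real.sq_sqrt hQpos.le]
  have hρsq_le : ρ ^ 2 ≤ r₀ ^ 2 := pow_le_pow_left₀ hρpos.le hρle 2
  -- the parabolic window `[t₀ - ρ², t₀] ⊆ [0, t₀] ⊆ [0, T)`
  have hwin : Icc (t₀ - ρ ^ 2) t₀ ⊆ Icc 0 t₀ :=
    Icc_subset_Icc (by linarith) le_rfl
  have hwin' : Icc (t₀ - ρ ^ 2) t₀ ⊆ Ico 0 T :=
    fun t ht ↦ ⟨(hwin ht).1, (hwin ht).2.trans_lt ht₀.2⟩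
  -- the curvature hypothesis `|Rm| ≤ ρ⁻²` on the window (even globally)
  have hcurv' : ∀ t ∈ Icc (t₀ - ρ ^ 2) t₀,
      CurvatureBoundedOn (g t) (cov t) ((g t).ball x₀ (ENNReal.ofReal ρ)) (ρ⁻¹ ^ 2) := by
    intro t ht
    have ht' : t ∈ Ico 0 T := hwin' ht
    have hB : CurvatureBoundedBy (g t) (cov t) (Real.sqrt (Q ^ 2)) :=
      curvatureBoundedBy_of_curvNormSqWith_le (hRiem t ht') (hflow.isLeviCivita t ht')
        (fun x ↦ hcurv t (hwin ht) x)
    rw [Real.sqrt_sq hQpos.le] at hB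
    have hQle : Q ≤ ρ⁻¹ ^ 2 := by
      rw [inv_pow, hρsq, inv_div, le_div_iff₀ (pow_pos hr₀pos 2)]
      have : r₀ ^ 2 ≤ 1 := pow_le_one₀ hr₀pos.le hr₀le1
      nlinarith
    exact (curvatureBoundedOn_univ_iff.mpr hB).mono (subset_univ _) hQle
  have hvol := hnc ρ hρpos hρlt x₀ t₀ hwin' hcurv'
  rw [finrank_euclideanSpace_fin] at hvol
  -- convert to the rescaled metric: `B_{Q g}(x₀, √Q ρ) = B_g(x₀, ρ)`, `Vol_{Q g} = Q² Vol_g`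
  rw [← hρr, ball_constSmul_ofReal _ hQpos, vol_constSmul_four _ hQpos]
  have h4 : κ * (Real.sqrt Q * ρ) ^ 4 = Q ^ 2 * (κ * ρ ^ 4) := by
    have : Real.sqrt Q ^ 4 = Q ^ 2 := by
      calc Real.sqrt Q ^ 4 = (Real.sqrt Q ^ 2) ^ 2 := by ring
        _ = Q ^ 2 := by rw [Real.sq_sqrt hQpos.le]
    rw [mul_pow, this]
    ring
  rw [h4, ENNReal.ofReal_mul (sq_nonneg Q)]
  gcongr

end Summit.SmoothPoincare4.SmoothPoincare4.Theorems.MargerinRails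

end
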